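import Summits.QuantumFields.BalabanUV.Beta.WardLocusCombSockets
import Summits.QuantumFields.BalabanUV.Beta.WardLocusSymSecondOrder

/-!
# `BalabanUV.Beta.WardLocusCombSecondOrder` — binder row D1, RULING R-D1-g35-1 (chart (III′)), brick P4c-W-iii: **THE SECOND-ORDER WARD KERNEL LAW (Wd) OF THE
# CHART-(III′) LITERAL's W-TABLES `WcombOf tabs` AT EVERY LEVEL, FROM TABLE LETTERS** — `WardLocusSymSecondOrder.exists_kernelLaws_WsymOf_of_letters` (chart (II), gen 29)
# RE-RUN: the slot-generic chain `WardLocusRecursiveLettersSlot.exists_kernelLaws_of_letters_slot` at `(G, 𝕄, E) := (GcombSh Lc, bhKStepSh d Lc (Dsh Lc), axEc ρ_c Lc)` with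
# EVERY resolvent socket a THEOREM of this gen: `hR := P2`, `hHc := colH_ward_GcombSh`, `hMw := colM_GcombSh_ward`, `hoff := GcombSh_inr_inr_off`, `hEX := comp_axEc_diagK_comm`,
# `hD := divV_dM_SpureCombOf_eq_conjV`, `hGt := trK_GcombSh`; DISPLAYED (as in chart (II)): (V-d), (c1) at `G′`, the row parities (Sp)(Mp), the table letters (T2-W)(T2-B)(T2-M₂)
# with their remainders' classes and parities

HONEST FRAMING (cell contract, verbatim): «discharging `BetaPertH` makes Bałaban's UV stability UNCONDITIONAL — a real constructive-QFT
result; it is NOT the continuum limit and NOT the Clay problem.»  HONEST DEPENDENCY: continuum YM on T⁴ ⇐ BetaPertH ∧ nine spine estimates (0/9 proved);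
BetaPertH ⇐ (D1) ∧ (D4) ∧ CAP+tail; G-an2-4 gates asym, D1 and NE2/3/4.
DERIVED cell leaf ([folklore] wiring BY NAME; β sub-cell, BINDER-OWNERS row D1 OWNER `b2b-balaban-beta-an2` gen 36).  No statement of Bałaban's papers, no `[cite:]`,
no `Prop` fact, no `def`.  CONCLUSION: a residual family `Nr` (uniform vertex-family class per level, parity-odd rows) with
`∀ j y ν y′, divW (WcombOf tabs … j) y ν y′ = conjV (dM (GcombSh Lc j) Lc (SpureCombOf tabs … j) (tabs.M j) ν y′) (diagK (½ • Σ_v legInd ρ_c (Lc•y+v))) + Nr j y ν y′` — the (Wd)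
letter of the chart-(III′) Ward END (`CombChartWardEnd.wardTransversal_flipK_TbalOf_JsB12CombShSym_rel_parity`) modulo (c1) at `G′` (the dM-vertex ↦ ℋ-column-vertex
consistency, displayed; chart (II)'s is `LagrangeFoldSym.dM_SpureRecOf_M1Of_eq_vertexOfK_SrecOf` — its (III′) twin is the LOCATED OPEN socket of P4c-W) and `X₂ʷ := 0`.
HONEST: the table letters and (c1) are HYPOTHESES; 0∕4 row-D1 binders; RECORD = ROOT M′ p303989; NOT D1, NOT `BetaPertH`, NOT continuum, NOT Clay.
Provenance: β sub-cell, unit beta-an2 gen 36, 2026-08-22 (v1); over `WardLocusCombSockets`, `CombChartWardSockets`, `CombChartHColumnWard`, P2, P3 (this gen ∕ gen 35) and the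
slot-generic `WardLocusRecursiveLettersSlot` (leaf lineage) BY NAME; no existing file touched.
-/

noncomputable section

open Finset
open scoped BigOperators
open Literature.MathematicalPhysics.QuantumFieldTheory
open Literature.MathematicalPhysics.QuantumFieldTheory.Balaban1983to89
open Literature.MathematicalPhysics.QuantumFieldTheory.Balaban1983to89.Beta
open B6BondElimination (unitVec)
open ExpKernelCalculus (MKer Decays BiLoc VertexFamily VertexFamily₂ comp)
open KernelWard (divV divW)
open AffineAveraging (Site box toSite)
open AveragingContoursRooted (ctr ctrOff ctrOff_mem_box)
open OneStepResolventKernel (Fib wsum LocStencil)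
open OneStepKernelFamily (KInvStep colH vertexOfK)
open InterLevelTransport (cwsum)
open BalabanStepJetsSucc (mmRead wE wVH)
open SecondOrderResponse (colM vertexOfM dM LocStencilFM)
open BalabanCompositeJets (LocStencil₂)
open BalabanStepW2 (M2Of wV4 wB2)
open StepJetData (wilsonA)
open WilsonBiStencil (wilsonW₂)
open Summit.QuantumFields.BalabanUV.Beta.TameKernelCalculus
open Summit.QuantumFields.BalabanUV.Beta.ChartConjugation (conjV)
open Summit.QuantumFields.BalabanUV.Beta.ChartConjugationRelative (RelInv)
open Summit.QuantumFields.BalabanUV.Beta.AxialDressingRooted (one_le_of_neZero axEc spr_axEc)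
open Summit.QuantumFields.BalabanUV.Beta.BorderedHessian (bhK stepScale diagK sgnK comp_axEc_diagK_comm)
open Summit.QuantumFields.BalabanUV.Beta.AveragingWardRootedStencils (legInd)
open Summit.QuantumFields.BalabanUV.Beta.WardLocusStencils (ffK)
open Summit.QuantumFields.BalabanUV.Beta.KernelWardRelative (gaugeWt)
open Summit.QuantumFields.BalabanUV.Beta.SymmetrisedStepJets (SymTables)
open Summit.QuantumFields.BalabanUV.Beta.SymShiftedSpread (bhKStepSh spr_bhKStepSh)
open Summit.QuantumFields.BalabanUV.Beta.DshAn1 (Dsh spr_Dsh)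
open Summit.QuantumFields.BalabanUV.Beta.WardLocusQuarticTable (lock_succ_of_pin)
open Summit.QuantumFields.BalabanUV.Beta.WardLocusRecursiveLettersSlot (exists_kernelLaws_of_letters_slot)
open Summit.QuantumFields.BalabanUV.Beta.CombChartStepJets (GcombSh decays_GcombSh ScombOf SpureCombOf SpureCombOf_eq WcombOf WcombOf_eq)
open Summit.QuantumFields.BalabanUV.Beta.RelInvCombShiftedSpread (relInv_coDressKAt_Gsym_bhKStepSh)
open Summit.QuantumFields.BalabanUV.Beta.CombChartHColumnWard (colH_ward_GcombSh)
open Summit.QuantumFields.BalabanUV.Beta.CombChartWardSockets (colM_GcombSh_ward GcombSh_inr_inr_off trK_GcombSh)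
open Summit.QuantumFields.BalabanUV.Beta.WardLocusCombSockets (divV_dM_SpureCombOf_eq_conjV)

namespace Summit.QuantumFields.BalabanUV.Beta.WardLocusCombSecondOrder

section Literal

variable {d Lc : ℕ} [NeZero Lc]

/-- [folklore] **THE SECOND-ORDER WARD KERNEL LAW OF THE (III′) LITERAL's W-TABLES `WcombOf tabs` AT EVERY LEVEL, FROM TABLE LETTERS** (generic `d`; pins of record
`(cE, cVH) = (Lc^{d+1}, −Lc^{d+1}·½·Lc^{d+1})`, `cE₂ = Lc^{2(d+1)}`; root `ρ_c`, generator `X y = diagK (½ • Σ_v legInd ρ_c (Lc•y+v))`).  Every resolvent socket of the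
slot-generic chain is DISCHARGED at (`GcombSh`, `bhKStepSh d Lc (Dsh Lc)`, `axEc ρ_c Lc`).  DISPLAYED: (V-d); (c1) at `G′`; the row parities (Sp)(Mp); the table letters
(T2-W)(T2-B)(T2-M₂) with their remainders' classes and parities. -/
theorem exists_kernelLaws_WcombOf_of_letters (tabs : SymTables d Lc)
    -- the border letter (V-d) of `tabs.V` against an1's typed legged border
    (hVd : ∀ u : Fin (d + 1) → ℤ, conjV (bhK Lc + Dsh Lc) (diagK (legInd (ctr (d + 1) Lc) u)) =
      conjV (ffK (bhK (d := d) Lc)) (diagK (legInd (ctr (d + 1) Lc) u)) - ((Lc : ℝ) ^ (d + 1)) • divV tabs.V u)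
    (cΛ cB : ℝ) {cE₂ : ℝ} (hcE₂ : cE₂ = (Lc : ℝ) ^ (2 * (d + 1))) (T : Fin 4 → Fin 4 → Fin 4 → Fin 4 → ℝ)
    -- (c1) the order-one consistency of the multiplier table with the Λ-sector, every level
    (hc1 : ∀ (j : ℕ) (κ : Fin (d + 1)) (u : Fin (d + 1) → ℤ),
      dM (GcombSh Lc j) Lc (SpureCombOf tabs ((Lc : ℝ) ^ (d + 1)) (-((Lc : ℝ) ^ (d + 1) * (1 / 2) * (Lc : ℝ) ^ (d + 1))) cΛ j) (tabs.M j) κ u = vertexOfK (GcombSh Lc j) Lc (ScombOf tabs ((Lc : ℝ) ^ (d + 1)) (-((Lc : ℝ) ^ (d + 1) * (1 / 2) * (Lc : ℝ) ^ (d + 1))) cΛ j) κ u)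
    -- (Sp)(Mp) the row parities of the first-order tables
    (hSp : ∀ (j : ℕ) (κ : Fin (d + 1)) (u : Fin (d + 1) → ℤ), trK (SpureCombOf tabs ((Lc : ℝ) ^ (d + 1)) (-((Lc : ℝ) ^ (d + 1) * (1 / 2) * (Lc : ℝ) ^ (d + 1))) cΛ j κ u) = -sgnK (SpureCombOf tabs ((Lc : ℝ) ^ (d + 1)) (-((Lc : ℝ) ^ (d + 1) * (1 / 2) * (Lc : ℝ) ^ (d + 1))) cΛ j κ u))
    (hMp : ∀ (j : ℕ) (ρ : Fin (d + 1)) (w : Fin (d + 1) → ℤ), trK (tabs.M j ρ w) = -sgnK (tabs.M j ρ w))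
    -- the LETTERS' remainders, their classes (one rate per level) and row parities
    {RW RW'' : (Fin (d + 1) → ℤ) → Fin (d + 1) → (Fin (d + 1) → ℤ) → MKer (d + 1) (Fib d)}
    {RB RB'' : ℕ → (Fin (d + 1) → ℤ) → Fin (d + 1) → (Fin (d + 1) → ℤ) → MKer (d + 1) (Fib d)}
    {RM : ℕ → (Fin (d + 1) → ℤ) → Fin (d + 1) → (Fin (d + 1) → ℤ) → MKer (d + 1) (Fib d)}
    (hcls0 : ∃ C δ : ℝ, 0 < δ ∧ (∀ Y, LocStencil (RW Y) C δ) ∧ (∀ Y, LocStencil (RW'' Y) C δ) ∧ (∀ Y, LocStencil (RB 0 Y) C δ) ∧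
      (∀ Y, LocStencil (RB'' 0 Y) C δ) ∧ (∀ y, VertexFamily (RM 0 y) Lc C δ))
    (hclsS : ∀ j : ℕ, ∃ C δ : ℝ, 0 < δ ∧ (∀ Y, LocStencil (RB (j + 1) Y) C δ) ∧ (∀ Y, LocStencil (RB'' (j + 1) Y) C δ) ∧
      (∀ y, VertexFamily (RM (j + 1) y) Lc C δ))
    (hRWp : ∀ Y κ u, trK (RW Y κ u) = -sgnK (RW Y κ u)) (hRW''p : ∀ Y κ u, trK (RW'' Y κ u) = -sgnK (RW'' Y κ u))
    (hRBp : ∀ j Y κ u, trK (RB j Y κ u) = -sgnK (RB j Y κ u)) (hRB''p : ∀ j Y κ u, trK (RB'' j Y κ u) = -sgnK (RB'' j Y κ u))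
    (hRMp : ∀ j y ρ' w, trK (RM j y ρ' w) = -sgnK (RM j y ρ' w))
    -- (T2-W) the level-0 Wilson Ward law, both slots
    (hWil : ∀ (Y : Fin (d + 1) → ℤ) (κ' : Fin (d + 1)) (u' : Fin (d + 1) → ℤ),
      (stepScale d Lc 0 * (Lc : ℝ) ^ (d + 1))⁻¹ • ∑ v ∈ box (d + 1) Lc, divV (fun κ u => cE₂ • wilsonW₂ d T κ u κ' u') ((Lc : ℤ) • Y + toSite v) =
        comp (((Lc : ℝ) ^ (d + 1)) • wilsonA d κ' u') (diagK ((1 / 2 : ℝ) • ∑ v ∈ box (d + 1) Lc, legInd (ctr (d + 1) Lc) ((Lc : ℤ) • Y + toSite v)))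
          - comp (diagK ((1 / 2 : ℝ) • ∑ v ∈ box (d + 1) Lc, legInd (ctr (d + 1) Lc) ((Lc : ℤ) • Y + toSite v))) (((Lc : ℝ) ^ (d + 1)) • wilsonA d κ' u') + RW Y κ' u')
    (hWil'' : ∀ (Y : Fin (d + 1) → ℤ) (κ : Fin (d + 1)) (u : Fin (d + 1) → ℤ),
      (stepScale d Lc 0 * (Lc : ℝ) ^ (d + 1))⁻¹ • ∑ v ∈ box (d + 1) Lc, divV (fun κ' u' => cE₂ • wilsonW₂ d T κ u κ' u') ((Lc : ℤ) • Y + toSite v) =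
        comp (((Lc : ℝ) ^ (d + 1)) • wilsonA d κ u) (diagK ((1 / 2 : ℝ) • ∑ v ∈ box (d + 1) Lc, legInd (ctr (d + 1) Lc) ((Lc : ℤ) • Y + toSite v)))
          - comp (diagK ((1 / 2 : ℝ) • ∑ v ∈ box (d + 1) Lc, legInd (ctr (d + 1) Lc) ((Lc : ℤ) • Y + toSite v))) (((Lc : ℝ) ^ (d + 1)) • wilsonA d κ u) + RW'' Y κ u)
    -- (T2-B) the border Ward law of `tabs.vh₂S` against `tabs.V`, both slots, level 0 and level j+1
    (hBord0 : ∀ (Y : Fin (d + 1) → ℤ) (κ' : Fin (d + 1)) (u' : Fin (d + 1) → ℤ),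
      (stepScale d Lc 0 * (Lc : ℝ) ^ (d + 1))⁻¹ • ∑ v ∈ box (d + 1) Lc, divV (fun κ u => cB • tabs.vh₂S κ u κ' u') ((Lc : ℤ) • Y + toSite v) =
        comp ((-((Lc : ℝ) ^ (d + 1) * (1 / 2) * (Lc : ℝ) ^ (d + 1))) • tabs.V κ' u') (diagK ((1 / 2 : ℝ) • ∑ v ∈ box (d + 1) Lc, legInd (ctr (d + 1) Lc) ((Lc : ℤ) • Y + toSite v)))
          - comp (diagK ((1 / 2 : ℝ) • ∑ v ∈ box (d + 1) Lc, legInd (ctr (d + 1) Lc) ((Lc : ℤ) • Y + toSite v))) ((-((Lc : ℝ) ^ (d + 1) * (1 / 2) * (Lc : ℝ) ^ (d + 1))) • tabs.V κ' u') + RB 0 Y κ' u')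
    (hBord0'' : ∀ (Y : Fin (d + 1) → ℤ) (κ : Fin (d + 1)) (u : Fin (d + 1) → ℤ),
      (stepScale d Lc 0 * (Lc : ℝ) ^ (d + 1))⁻¹ • ∑ v ∈ box (d + 1) Lc, divV (fun κ' u' => cB • tabs.vh₂S κ u κ' u') ((Lc : ℤ) • Y + toSite v) =
        comp ((-((Lc : ℝ) ^ (d + 1) * (1 / 2) * (Lc : ℝ) ^ (d + 1))) • tabs.V κ u) (diagK ((1 / 2 : ℝ) • ∑ v ∈ box (d + 1) Lc, legInd (ctr (d + 1) Lc) ((Lc : ℤ) • Y + toSite v)))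
          - comp (diagK ((1 / 2 : ℝ) • ∑ v ∈ box (d + 1) Lc, legInd (ctr (d + 1) Lc) ((Lc : ℤ) • Y + toSite v))) ((-((Lc : ℝ) ^ (d + 1) * (1 / 2) * (Lc : ℝ) ^ (d + 1))) • tabs.V κ u) + RB'' 0 Y κ u)
    (hBordS : ∀ (j : ℕ) (Y : Fin (d + 1) → ℤ) (κ' : Fin (d + 1)) (u' : Fin (d + 1) → ℤ),
      (stepScale d Lc (j + 1) * (Lc : ℝ) ^ (d + 1))⁻¹ • ∑ v ∈ box (d + 1) Lc, divV (fun κ u => (cB * wB2 d Lc (j + 1)) • tabs.vh₂S κ u κ' u') ((Lc : ℤ) • Y + toSite v) =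
        comp (((-((Lc : ℝ) ^ (d + 1) * (1 / 2) * (Lc : ℝ) ^ (d + 1))) * wVH d Lc (j + 1)) • tabs.V κ' u') (diagK ((1 / 2 : ℝ) • ∑ v ∈ box (d + 1) Lc, legInd (ctr (d + 1) Lc) ((Lc : ℤ) • Y + toSite v)))
          - comp (diagK ((1 / 2 : ℝ) • ∑ v ∈ box (d + 1) Lc, legInd (ctr (d + 1) Lc) ((Lc : ℤ) • Y + toSite v))) (((-((Lc : ℝ) ^ (d + 1) * (1 / 2) * (Lc : ℝ) ^ (d + 1))) * wVH d Lc (j + 1)) • tabs.V κ' u') + RB (j + 1) Y κ' u')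
    (hBordS'' : ∀ (j : ℕ) (Y : Fin (d + 1) → ℤ) (κ : Fin (d + 1)) (u : Fin (d + 1) → ℤ),
      (stepScale d Lc (j + 1) * (Lc : ℝ) ^ (d + 1))⁻¹ • ∑ v ∈ box (d + 1) Lc, divV (fun κ' u' => (cB * wB2 d Lc (j + 1)) • tabs.vh₂S κ u κ' u') ((Lc : ℤ) • Y + toSite v) =
        comp (((-((Lc : ℝ) ^ (d + 1) * (1 / 2) * (Lc : ℝ) ^ (d + 1))) * wVH d Lc (j + 1)) • tabs.V κ u) (diagK ((1 / 2 : ℝ) • ∑ v ∈ box (d + 1) Lc, legInd (ctr (d + 1) Lc) ((Lc : ℤ) • Y + toSite v)))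
          - comp (diagK ((1 / 2 : ℝ) • ∑ v ∈ box (d + 1) Lc, legInd (ctr (d + 1) Lc) ((Lc : ℤ) • Y + toSite v))) (((-((Lc : ℝ) ^ (d + 1) * (1 / 2) * (Lc : ℝ) ^ (d + 1))) * wVH d Lc (j + 1)) • tabs.V κ u) + RB'' (j + 1) Y κ u)
    -- (T2-M₂) the mixed Ward law of `M2Of tabs.mixFF j` against `tabs.M j`, every level
    (hM₂ : ∀ (j : ℕ) (y : Fin (d + 1) → ℤ) (ρ' : Fin (d + 1)) (w : Fin (d + 1) → ℤ),
      (stepScale d Lc j * (Lc : ℝ) ^ (d + 1))⁻¹ • ∑ v ∈ box (d + 1) Lc, divV (fun κ u => M2Of d Lc tabs.mixFF j κ u ρ' w) ((Lc : ℤ) • y + toSite v) =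
        comp (tabs.M j ρ' w) (diagK ((1 / 2 : ℝ) • ∑ v ∈ box (d + 1) Lc, legInd (ctr (d + 1) Lc) ((Lc : ℤ) • y + toSite v))) - comp (diagK ((1 / 2 : ℝ) • ∑ v ∈ box (d + 1) Lc, legInd (ctr (d + 1) Lc) ((Lc : ℤ) • y + toSite v))) (tabs.M j ρ' w) + RM j y ρ' w) :
    ∃ Nr : ℕ → (Fin (d + 1) → ℤ) → Fin (d + 1) → (Fin (d + 1) → ℤ) → MKer (d + 1) (Fib d),
      (∀ j, ∃ C δ : ℝ, 0 < δ ∧ ∀ y, VertexFamily (Nr j y) Lc C δ) ∧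
      (∀ j y ν y', trK (Nr j y ν y') = -sgnK (Nr j y ν y')) ∧
      (∀ (j : ℕ) (y : Fin (d + 1) → ℤ) (ν : Fin (d + 1)) (y' : Fin (d + 1) → ℤ),
        divW (WcombOf tabs ((Lc : ℝ) ^ (d + 1)) (-((Lc : ℝ) ^ (d + 1) * (1 / 2) * (Lc : ℝ) ^ (d + 1))) cΛ cE₂ cB T j) y ν y' =
          conjV (dM (GcombSh Lc j) Lc (SpureCombOf tabs ((Lc : ℝ) ^ (d + 1)) (-((Lc : ℝ) ^ (d + 1) * (1 / 2) * (Lc : ℝ) ^ (d + 1))) cΛ j) (tabs.M j) ν y') (diagK ((1 / 2 : ℝ) • ∑ v ∈ box (d + 1) Lc, legInd (ctr (d + 1) Lc) ((Lc : ℤ) • y + toSite v))) + Nr j y ν y') := by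
  have hLc : 1 ≤ Lc := one_le_of_neZero Lc
  have hr : ctrOff (d + 1) Lc ∈ box (d + 1) Lc := ctrOff_mem_box hLc
  simp only [WcombOf_eq, ← SpureCombOf_eq]
  exact exists_kernelLaws_of_letters_slot (V := tabs.V) (H := tabs.H) (G := GcombSh Lc) (M := tabs.M) hLc tabs.hV tabs.hH (decays_GcombSh Lc) tabs.hM
    _ _ cΛ cE₂ cB T tabs.hB tabs.hmix (fun j => bhKStepSh d Lc (Dsh Lc) j) (spr_bhKStepSh (spr_Dsh hLc)) (axEc (ctr (d + 1) Lc) Lc) (spr_axEc _ _)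
    (fun j => relInv_coDressKAt_Gsym_bhKStepSh (d := d) (Lc := Lc) j)
    (fun j => (stepScale d Lc j * (Lc : ℝ) ^ (d + 1))⁻¹) (fun j y κ' u => colH_ward_GcombSh (d := d) (Lc := Lc) j y κ' u)
    (fun j y ρ w => colM_GcombSh_ward (d := d) (Lc := Lc) j y ρ w) (fun j x hx z ρ μ => GcombSh_inr_inr_off (d := d) (Lc := Lc) j x hx z ρ μ) hr (1 / 2 : ℝ)
    (fun y => comp_axEc_diagK_comm _ _ _) (fun j y => divV_dM_SpureCombOf_eq_conjV tabs hVd cΛ j y) hc1 (fun j => trK_GcombSh (d := d) (Lc := Lc) j) hSp hMp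
    (fun j => lock_succ_of_pin (d := d) hLc hcE₂ j) hcls0 hclsS hRWp hRW''p hRBp hRB''p hRMp hWil hWil'' hBord0 hBord0'' hBordS hBordS'' hM₂

end Literal

end Summit.QuantumFields.BalabanUV.Beta.WardLocusCombSecondOrder

end
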